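import Mathlib.Analysis.Complex.Basic
import Mathlib.Analysis.SpecialFunctions.Pow.Real
import Mathlib.Algebra.Order.BigOperators.Ring.Finset
import HarnessLib

/-!
# Route `PrimeLevelFamEdge`, crux K_B (stmt-Parity-20343), line `diagonal_kernel_split` rev 4, plan Ω,
# node **L7d `OffDiagLargeConductorBound` (part 1, abstract assembly)** — the dispersion-free Cauchy–Schwarz
# assembly of a FAMILY of weighted level sums against the large-conductor ℓ²-input (E18), with the Taylor
# separation of the level weight (L7c) and the fibre multiplicities of the class map (L7b) as explicit slots

OMEGA-BLUEPRINT v4 §3c re-homes a8R (conductors `> R = N^{δ}`) on the large sieve: keep the residue classes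
INSIDE, expand the level weight `F_x(q)` of each cell `x = (l, m, s, d, c, i, h₁, …)` in a common basis
`F_x = Σ_{j<J} T_j(x)·P_j + E_x` (L7c `OffDiagLevelSeparation`: Taylor in `q` on a sub-block, `P_j(q) = (q − t₀)^j`),
collect the cells by their key `κ(x) = (modulus, class)` into class weights `W_j(k) = Σ_{κ(x)=k} w_x T_j(x)`, and
bound `Σ_k W_j(k)·Λ_k[P_j]` by Cauchy–Schwarz against the ℓ²-input
`Σ_k |Λ_k[P_j]|² ≤ V·Σ_q |P_j(q)|²` (E18 / L7a / L7-bridge (v): `Λ_k = L_R(h,c)`, the conductor-`> R` part of the class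
sum, `V = (1 + log Q)²(2(N′+1)/R + 4Q)`), the class weights by the FIBRE MULTIPLICITIES
`m(x) = #{x′ : κ(x′) = κ(x)}` (L7b `OffDiagFlatness`): `Σ_k |W_j(k)|² ≤ Σ_x m(x)|w_x T_j(x)|²`.
This file is that assembly, for an ARBITRARY finite family — no K_B object is imported, so that the concrete
instantiation (part 2: `x` = the cells of S3's block switch on a sub-block of levels, `Λ` = L7-bridge's `L_R`,
`m` from L7b, `T_j, E_x` from L7c) is a substitution:

* `sum_norm_sq_fiber_le` — `Σ_{k∈K} ‖Σ_{x∈X, κ x = k} v x‖² ≤ Σ_{x∈X} m(x)·‖v x‖²` (Cauchy–Schwarz per fibre);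
* `norm_sum_mul_le_sqrt_mul_sqrt` — `‖Σ_k W_k Λ_k‖ ≤ (Σ‖W_k‖²)^{1/2}(Σ‖Λ_k‖²)^{1/2}`;
* `apply_sum_mul_add_eq` — finite linearity of an additive, homogeneous functional;
* **`norm_sum_weight_functional_le`** — for additive homogeneous functionals `Λ_k` (`k ∈ K`), weights `w`, level
  weights `F_x = Σ_{j<J} T_j(x) P_j + E_x`, the ℓ²-input `Σ_{k∈K}‖Λ_k P_j‖² ≤ V·Σ_{n∈S}‖P_j n‖²` and remainder bounds
  `‖Λ_{κ x} E_x‖ ≤ ρ_x`: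
  `‖Σ_{x∈X} w_x·Λ_{κ x}[F_x]‖ ≤ Σ_{j<J} (Σ_x m(x)‖w_x T_j(x)‖²)^{1/2}·(V·Σ_{n∈S}‖P_j n‖²)^{1/2} + Σ_x ‖w_x‖ρ_x`;
* `l7Window_nonempty` — the real-exponent window of v4 §3c as printed (saving `N^{−δ/2}` beats the trivial ledger
  `N^{(5/4)η+2ε₀+ε}` with `δ = 3η`, and `N/R` dominates `4Q`, i.e. `δ < ½ − η − 3ε`), non-empty for `0 < η < 1/10`.

Pure finite-sum inequalities; theorems only; standard axioms. Helper toward `stub_offDiagBelowSlack_io`; closes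
nothing. NOT claimed: that the K_B cells satisfy the ℓ²-input with an affordable `V` outside the domain
{balanced boxes} × {sub-blocks of relative length ≤ q^{−ε}/(1+Z)} × {cells with a long level window} (STATUS 16:29Z (α)–(γ)).
«The programme SEARCHES and TYPES; no claim about Landau–Siegel zeros, Theorems 1–2 of arXiv:2211.02515 or
a repaired Margin232 until a kernel theorem says so.»
-/

noncomputable section

namespace Summit.Parity.GeneralizedHardyLittlewood.Theorems.BeyondDiagonalBeatsQuarter.OffDiag

open Finset

variable {ι β : Type*} [DecidableEq β]

/-! ### §1. Fibre Cauchy–Schwarz and the pairing -/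

/-- **Cauchy–Schwarz per fibre of the class map**: `Σ_{k∈K} ‖Σ_{x∈X, κ x = k} v x‖² ≤ Σ_{x∈X} m(x)·‖v x‖²`,
`m(x) = #{x′ ∈ X : κ x′ = κ x}` (requires `κ(X) ⊆ K`). [cite: Davenport1980, ch. 29 — derivation] -/
theorem sum_norm_sq_fiber_le (X : Finset ι) (K : Finset β) (κ : ι → β) (hκ : ∀ x ∈ X, κ x ∈ K)
    (v : ι → ℂ) :
    ∑ k ∈ K, ‖∑ x ∈ X with κ x = k, v x‖ ^ 2 ≤
      ∑ x ∈ X, ((X.filter (fun x' ↦ κ x' = κ x)).card : ℝ) * ‖v x‖ ^ 2 := by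
  have hfib : ∀ k ∈ K, ‖∑ x ∈ X with κ x = k, v x‖ ^ 2 ≤
      ∑ x ∈ X with κ x = k, ((X.filter (fun x' ↦ κ x' = κ x)).card : ℝ) * ‖v x‖ ^ 2 := by
    intro k _
    calc ‖∑ x ∈ X with κ x = k, v x‖ ^ 2 ≤ (∑ x ∈ X with κ x = k, ‖v x‖) ^ 2 := by
          gcongr
          exact norm_sum_le _ _
      _ = (∑ x ∈ X with κ x = k, 1 * ‖v x‖) ^ 2 := by simp only [one_mul]
      _ ≤ (∑ x ∈ X with κ x = k, (1 : ℝ) ^ 2) * ∑ x ∈ X with κ x = k, ‖v x‖ ^ 2 :=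
          sum_mul_sq_le_sq_mul_sq _ _ _
      _ = ∑ x ∈ X with κ x = k, (((X.filter (fun x' ↦ κ x' = k)).card : ℝ) * ‖v x‖ ^ 2) := by
          rw [Finset.mul_sum]
          simp only [one_pow, Finset.sum_const, nsmul_eq_mul, mul_one]
      _ = ∑ x ∈ X with κ x = k, ((X.filter (fun x' ↦ κ x' = κ x)).card : ℝ) * ‖v x‖ ^ 2 := by
          refine Finset.sum_congr rfl fun x hx ↦ ?_
          rw [(Finset.mem_filter.mp hx).2]
  calc _ ≤ ∑ k ∈ K, ∑ x ∈ X with κ x = k, ((X.filter (fun x' ↦ κ x' = κ x)).card : ℝ) * ‖v x‖ ^ 2 :=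
        Finset.sum_le_sum hfib
    _ = _ := Finset.sum_fiberwise_of_maps_to hκ _

omit [DecidableEq β] in
/-- **Cauchy–Schwarz for the pairing** `‖Σ_{k∈K} W_k·Λ_k‖ ≤ (Σ‖W_k‖²)^{1/2}·(Σ‖Λ_k‖²)^{1/2}`. [folklore] -/
theorem norm_sum_mul_le_sqrt_mul_sqrt (K : Finset β) (W Λ : β → ℂ) :
    ‖∑ k ∈ K, W k * Λ k‖ ≤ Real.sqrt (∑ k ∈ K, ‖W k‖ ^ 2) * Real.sqrt (∑ k ∈ K, ‖Λ k‖ ^ 2) := by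
  have h1 : ‖∑ k ∈ K, W k * Λ k‖ ≤ ∑ k ∈ K, ‖W k‖ * ‖Λ k‖ :=
    (norm_sum_le _ _).trans (le_of_eq (Finset.sum_congr rfl fun k _ ↦ norm_mul _ _))
  have h2 : (∑ k ∈ K, ‖W k‖ * ‖Λ k‖) ^ 2 ≤ (∑ k ∈ K, ‖W k‖ ^ 2) * ∑ k ∈ K, ‖Λ k‖ ^ 2 :=
    sum_mul_sq_le_sq_mul_sq _ _ _
  have h0 : 0 ≤ ∑ k ∈ K, ‖W k‖ * ‖Λ k‖ := Finset.sum_nonneg fun k _ ↦ by positivity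
  have h3 : ∑ k ∈ K, ‖W k‖ * ‖Λ k‖ ≤ Real.sqrt ((∑ k ∈ K, ‖W k‖ ^ 2) * ∑ k ∈ K, ‖Λ k‖ ^ 2) := by
    rw [← Real.sqrt_sq h0]
    exact Real.sqrt_le_sqrt h2
  rw [← Real.sqrt_mul (Finset.sum_nonneg fun k _ ↦ by positivity)]
  exact h1.trans h3

/-! ### §2. Finite linearity of the functionals -/

/-- An additive and homogeneous functional is linear over finite combinations plus a remainder:
`Λ(Σ_{j∈s} c_j·P_j + e) = Σ_{j∈s} c_j·Λ(P_j) + Λ(e)`. [folklore] -/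
theorem apply_sum_mul_add_eq (Λ : (ℕ → ℂ) → ℂ)
    (hadd : ∀ a b : ℕ → ℂ, Λ (fun n ↦ a n + b n) = Λ a + Λ b)
    (hsmul : ∀ (z : ℂ) (a : ℕ → ℂ), Λ (fun n ↦ z * a n) = z * Λ a)
    (s : Finset ℕ) (c : ℕ → ℂ) (P : ℕ → ℕ → ℂ) (e : ℕ → ℂ) :
    Λ (fun n ↦ ∑ j ∈ s, c j * P j n + e n) = ∑ j ∈ s, c j * Λ (P j) + Λ e := by
  classical
  induction s using Finset.induction_on with
  | empty => simp
  | insert a s ha ih =>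
    have hfun : (fun n ↦ ∑ j ∈ insert a s, c j * P j n + e n) =
        fun n ↦ (fun n ↦ c a * P a n) n + (fun n ↦ ∑ j ∈ s, c j * P j n + e n) n := by
      funext n
      rw [Finset.sum_insert ha]
      ring
    rw [hfun, hadd, hsmul, ih, Finset.sum_insert ha]
    ring

/-! ### §3. The abstract assembly -/

/-- **L7d, abstract form: the large-conductor deviation of a weighted family of level sums.**
Index set `X` of cells with weights `w`, key map `κ : X → K` (modulus and class), additive homogeneous functionals
`Λ_k` (the conductor-`> R` parts of the class sums), level weights separated as `F_x = Σ_{j<J} T_j(x)·P_j + E_x`,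
the ℓ²-input `Σ_{k∈K} ‖Λ_k P_j‖² ≤ V·Σ_{n∈S} ‖P_j n‖²` for each `j` (E18) and remainder bounds `‖Λ_{κ x} E_x‖ ≤ ρ_x`. Then
`‖Σ_x w_x Λ_{κ x}[F_x]‖ ≤ Σ_{j<J} (Σ_x m(x)‖w_x T_j(x)‖²)^{1/2}·(V Σ_{n∈S}‖P_j n‖²)^{1/2} + Σ_x ‖w_x‖ρ_x`,
`m(x)` the fibre multiplicity of `κ` at `x`. [cite: Davenport1980, ch. 29 — derivation; IwaniecKowalski2004, §17.3 — derivation] -/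
theorem norm_sum_weight_functional_le (X : Finset ι) (K : Finset β) (κ : ι → β)
    (hκ : ∀ x ∈ X, κ x ∈ K) (Λ : β → (ℕ → ℂ) → ℂ)
    (hadd : ∀ k ∈ K, ∀ a b : ℕ → ℂ, Λ k (fun n ↦ a n + b n) = Λ k a + Λ k b)
    (hsmul : ∀ k ∈ K, ∀ (z : ℂ) (a : ℕ → ℂ), Λ k (fun n ↦ z * a n) = z * Λ k a)
    (w : ι → ℂ) (F E : ι → ℕ → ℂ) (J : ℕ) (T : ℕ → ι → ℂ) (P : ℕ → ℕ → ℂ)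
    (hF : ∀ x ∈ X, F x = fun n ↦ ∑ j ∈ Finset.range J, T j x * P j n + E x n)
    {V : ℝ} (S : Finset ℕ)
    (hP : ∀ j ∈ Finset.range J, ∑ k ∈ K, ‖Λ k (P j)‖ ^ 2 ≤ V * ∑ n ∈ S, ‖P j n‖ ^ 2)
    (ρ : ι → ℝ) (hE : ∀ x ∈ X, ‖Λ (κ x) (E x)‖ ≤ ρ x) :
    ‖∑ x ∈ X, w x * Λ (κ x) (F x)‖ ≤
      ∑ j ∈ Finset.range J,
          Real.sqrt (∑ x ∈ X, ((X.filter (fun x' ↦ κ x' = κ x)).card : ℝ) * ‖w x * T j x‖ ^ 2) *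
            Real.sqrt (V * ∑ n ∈ S, ‖P j n‖ ^ 2) +
        ∑ x ∈ X, ‖w x‖ * ρ x := by
  -- Step 1: expand each functional value
  have hexp : ∀ x ∈ X, Λ (κ x) (F x) = ∑ j ∈ Finset.range J, T j x * Λ (κ x) (P j) + Λ (κ x) (E x) := by
    intro x hx
    rw [hF x hx]
    exact apply_sum_mul_add_eq (Λ (κ x)) (hadd (κ x) (hκ x hx)) (hsmul (κ x) (hκ x hx)) _ _ _ _
  have hsplit : ∑ x ∈ X, w x * Λ (κ x) (F x) =
      ∑ j ∈ Finset.range J, ∑ x ∈ X, w x * T j x * Λ (κ x) (P j) + ∑ x ∈ X, w x * Λ (κ x) (E x) := by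
    rw [Finset.sum_comm, ← Finset.sum_add_distrib]
    refine Finset.sum_congr rfl fun x hx ↦ ?_
    rw [hexp x hx, mul_add, Finset.mul_sum]
    refine congrArg (· + _) (Finset.sum_congr rfl fun j _ ↦ ?_)
    ring
  -- Step 2: one `j`: collect by key, Cauchy–Schwarz, fibre bound, ℓ²-input
  have hj : ∀ j ∈ Finset.range J, ‖∑ x ∈ X, w x * T j x * Λ (κ x) (P j)‖ ≤
      Real.sqrt (∑ x ∈ X, ((X.filter (fun x' ↦ κ x' = κ x)).card : ℝ) * ‖w x * T j x‖ ^ 2) *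
        Real.sqrt (V * ∑ n ∈ S, ‖P j n‖ ^ 2) := by
    intro j hjJ
    have hcollect : ∑ x ∈ X, w x * T j x * Λ (κ x) (P j) =
        ∑ k ∈ K, (∑ x ∈ X with κ x = k, w x * T j x) * Λ k (P j) := by
      rw [← Finset.sum_fiberwise_of_maps_to hκ (fun x ↦ w x * T j x * Λ (κ x) (P j))]
      refine Finset.sum_congr rfl fun k _ ↦ ?_
      rw [Finset.sum_mul]
      refine Finset.sum_congr rfl fun x hx ↦ ?_
      rw [(Finset.mem_filter.mp hx).2]
    rw [hcollect]
    refine (norm_sum_mul_le_sqrt_mul_sqrt K _ _).trans ?_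
    exact mul_le_mul (Real.sqrt_le_sqrt (sum_norm_sq_fiber_le X K κ hκ _))
      (Real.sqrt_le_sqrt (hP j hjJ)) (Real.sqrt_nonneg _) (Real.sqrt_nonneg _)
  -- Step 3: the remainder
  have hrem : ‖∑ x ∈ X, w x * Λ (κ x) (E x)‖ ≤ ∑ x ∈ X, ‖w x‖ * ρ x := by
    refine (norm_sum_le _ _).trans (Finset.sum_le_sum fun x hx ↦ ?_)
    rw [norm_mul]
    exact mul_le_mul_of_nonneg_left (hE x hx) (norm_nonneg _)
  rw [hsplit]
  refine (norm_add_le _ _).trans (add_le_add ((norm_sum_le _ _).trans (Finset.sum_le_sum hj)) hrem)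

/-- **The same with a uniform multiplicity bound** `m(x) ≤ m₀` on `X` (the form L7b's flatness count delivers):
`‖Σ_x w_x Λ_{κ x}[F_x]‖ ≤ Σ_{j<J} (m₀·Σ_x ‖w_x T_j(x)‖²)^{1/2}·(V Σ_{n∈S}‖P_j n‖²)^{1/2} + Σ_x ‖w_x‖ρ_x`.
[cite: Davenport1980, ch. 29 — derivation] -/
theorem norm_sum_weight_functional_le_of_mult_le (X : Finset ι) (K : Finset β) (κ : ι → β)
    (hκ : ∀ x ∈ X, κ x ∈ K) (Λ : β → (ℕ → ℂ) → ℂ)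
    (hadd : ∀ k ∈ K, ∀ a b : ℕ → ℂ, Λ k (fun n ↦ a n + b n) = Λ k a + Λ k b)
    (hsmul : ∀ k ∈ K, ∀ (z : ℂ) (a : ℕ → ℂ), Λ k (fun n ↦ z * a n) = z * Λ k a)
    (w : ι → ℂ) (F E : ι → ℕ → ℂ) (J : ℕ) (T : ℕ → ι → ℂ) (P : ℕ → ℕ → ℂ)
    (hF : ∀ x ∈ X, F x = fun n ↦ ∑ j ∈ Finset.range J, T j x * P j n + E x n)
    {V : ℝ} (S : Finset ℕ)
    (hP : ∀ j ∈ Finset.range J, ∑ k ∈ K, ‖Λ k (P j)‖ ^ 2 ≤ V * ∑ n ∈ S, ‖P j n‖ ^ 2)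
    (ρ : ι → ℝ) (hE : ∀ x ∈ X, ‖Λ (κ x) (E x)‖ ≤ ρ x)
    {m₀ : ℝ} (hm : ∀ x ∈ X, ((X.filter (fun x' ↦ κ x' = κ x)).card : ℝ) ≤ m₀) :
    ‖∑ x ∈ X, w x * Λ (κ x) (F x)‖ ≤
      ∑ j ∈ Finset.range J,
          Real.sqrt (m₀ * ∑ x ∈ X, ‖w x * T j x‖ ^ 2) * Real.sqrt (V * ∑ n ∈ S, ‖P j n‖ ^ 2) +
        ∑ x ∈ X, ‖w x‖ * ρ x := by
  refine (norm_sum_weight_functional_le X K κ hκ Λ hadd hsmul w F E J T P hF S hP ρ hE).trans ?_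
  refine add_le_add (Finset.sum_le_sum fun j _ ↦ ?_) le_rfl
  refine mul_le_mul_of_nonneg_right (Real.sqrt_le_sqrt ?_) (Real.sqrt_nonneg _)
  rw [Finset.mul_sum]
  exact Finset.sum_le_sum fun x hx ↦ mul_le_mul_of_nonneg_right (hm x hx) (by positivity)

/-! ### §4. The real-exponent window of v4 §3c -/

/-- **The L7 window as printed in OMEGA-BLUEPRINT v4 §3c**: for `0 < η < 1/10`, with `δ = 3η` there are
`ε₀, ε > 0` with the large-conductor saving `N^{−δ/2}` beating the trivial ledger `N^{(5/4)η + 2ε₀ + ε}` and the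
`N/R` term of the large sieve dominating `4Q` (`δ < ½ − η − 3ε`). A closed system of real inequalities; it records
only that the printed exponent bookkeeping is consistent, nothing about the cells.
[cite: KowalskiMichelVanderKam2000, §6 p. 19 — derivation (exponent bookkeeping)] -/
theorem l7Window_nonempty {η : ℝ} (h0 : 0 < η) (h1 : η < 1 / 10) :
    ∃ δ ε₀ ε : ℝ, δ = 3 * η ∧ 0 < ε₀ ∧ ε₀ ≤ 1 ∧ 0 < ε ∧
      5 / 4 * η + 2 * ε₀ + ε < δ / 2 ∧ δ < 1 / 2 - η - 3 * ε := by
  refine ⟨3 * η, η / 16, η / 16, rfl, by positivity, by linarith, by positivity, by linarith, by linarith⟩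

end Summit.Parity.GeneralizedHardyLittlewood.Theorems.BeyondDiagonalBeatsQuarter.OffDiag
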